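import Summits.Ventures.PercRepro2.CaseOneReductions
import Summits.Ventures.PercRepro2.CaseOneRootEdge

/-!
# The reduction calculus extended by the invisible root edge (blind cell PercRepro2, p1 g29)

`CaseOneReductions` with one more step: an edge between the roots is deleted
(`closedAt_of_root_edge`). `RedStepE`, `ReducesE`, `IrreducibleE`, `exists_irreducibleE_reducesE`,
**`closedAt_of_irreducibleE`**: if every instance that is irreducible for the extended calculus is
closed, every instance is. An `IrreducibleE` instance is `Irreducible` and its roots are not adjacent
(`IrreducibleE.irreducible`, `IrreducibleE.not_root_edge`). Own code; standard axioms.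
-/

namespace Summit.Ventures.PercRepro2

namespace CaseOne

universe u

section RedE
variable {V : Type*}

/-- **One extended reduction step**: a step of the basic calculus, or the deletion of an edge between
the roots. -/
inductive RedStepE :
    (o a₁ a₂ a₃ b : V) → (E : Type u) → [Fintype E] → [DecidableEq E] → (E → Sym2 V) →
      (o' a₁' a₂' a₃' b' : V) → (E' : Type u) → [Fintype E'] → [DecidableEq E'] → (E' → Sym2 V) →
        Prop
  /-- a step of the basic calculus -/
  | base {o a₁ a₂ a₃ b : V} {E : Type u} [Fintype E] [DecidableEq E] {ends : E → Sym2 V}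
      {o' a₁' a₂' a₃' b' : V} {E' : Type u} [Fintype E'] [DecidableEq E'] {ends' : E' → Sym2 V}
      (h : RedStep o a₁ a₂ a₃ b E ends o' a₁' a₂' a₃' b' E' ends') :
      RedStepE o a₁ a₂ a₃ b E ends o' a₁' a₂' a₃' b' E' ends'
  /-- an edge between the roots is deleted (it is closed under `Q`) -/
  | rootEdge {o a₃ b : V} (E : Type u) [Fintype E] [DecidableEq E] (ends : E → Sym2 V) (a₁ a₂ : V)
      (e₀ : E) (he : ends e₀ = s(a₁, a₂)) :
      RedStepE o a₁ a₂ a₃ b E ends o a₁ a₂ a₃ b {e : E // e ≠ e₀} (restrictEnds ends e₀)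

/-- **Extended reductions**: finitely many extended steps. -/
inductive ReducesE :
    (o a₁ a₂ a₃ b : V) → (E : Type u) → [Fintype E] → [DecidableEq E] → (E → Sym2 V) →
      (o' a₁' a₂' a₃' b' : V) → (E' : Type u) → [Fintype E'] → [DecidableEq E'] → (E' → Sym2 V) →
        Prop
  /-- no step -/
  | refl (o a₁ a₂ a₃ b : V) (E : Type u) [Fintype E] [DecidableEq E] (ends : E → Sym2 V) :
      ReducesE o a₁ a₂ a₃ b E ends o a₁ a₂ a₃ b E ends
  /-- one more step after a reduction -/
  | tail {o a₁ a₂ a₃ b : V} {E : Type u} [Fintype E] [DecidableEq E] {ends : E → Sym2 V}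
      {om a₁m a₂m a₃m bm : V} {Em : Type u} [Fintype Em] [DecidableEq Em] {endsm : Em → Sym2 V}
      {o' a₁' a₂' a₃' b' : V} {E' : Type u} [Fintype E'] [DecidableEq E'] {ends' : E' → Sym2 V}
      (h : ReducesE o a₁ a₂ a₃ b E ends om a₁m a₂m a₃m bm Em endsm)
      (hstep : RedStepE om a₁m a₂m a₃m bm Em endsm o' a₁' a₂' a₃' b' E' ends') :
      ReducesE o a₁ a₂ a₃ b E ends o' a₁' a₂' a₃' b' E' ends'

/-- An extended step deletes one edge. -/
theorem RedStepE.card_lt {o a₁ a₂ a₃ b : V} {E : Type u} [Fintype E] [DecidableEq E]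
    {ends : E → Sym2 V} {o' a₁' a₂' a₃' b' : V} {E' : Type u} [Fintype E'] [DecidableEq E']
    {ends' : E' → Sym2 V} (h : RedStepE o a₁ a₂ a₃ b E ends o' a₁' a₂' a₃' b' E' ends') :
    Fintype.card E' < Fintype.card E := by
  cases h with
  | base h => exact h.card_lt
  | rootEdge E ends a₁ a₂ e₀ he => exact Fintype.card_subtype_lt (x := e₀) (by simp)

variable {R : Type*} [CommRing R] [LinearOrder R] [IsStrictOrderedRing R]

/-- **One extended step preserves the closed property upward.** -/
theorem closedAt_of_redStepE {o a₁ a₂ a₃ b : V} {E : Type u} [Fintype E] [DecidableEq E]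
    {ends : E → Sym2 V} {o' a₁' a₂' a₃' b' : V} {E' : Type u} [Fintype E'] [DecidableEq E']
    {ends' : E' → Sym2 V} (h : RedStepE o a₁ a₂ a₃ b E ends o' a₁' a₂' a₃' b' E' ends')
    (hc : ClosedAt R o' a₁' a₂' b' E' ends' a₃') : ClosedAt R o a₁ a₂ b E ends a₃ := by
  cases h with
  | base h => exact closedAt_of_redStep h hc
  | rootEdge E ends a₁ a₂ e₀ he => exact closedAt_of_root_edge he hc

/-- **The closed property is preserved upward along every extended reduction.** -/
theorem closedAt_of_reducesE {o a₁ a₂ a₃ b : V} {E : Type u} [Fintype E] [DecidableEq E]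
    {ends : E → Sym2 V} {o' a₁' a₂' a₃' b' : V} {E' : Type u} [Fintype E'] [DecidableEq E']
    {ends' : E' → Sym2 V} (h : ReducesE o a₁ a₂ a₃ b E ends o' a₁' a₂' a₃' b' E' ends')
    (hc : ClosedAt R o' a₁' a₂' b' E' ends' a₃') : ClosedAt R o a₁ a₂ b E ends a₃ := by
  induction h with
  | refl => exact hc
  | tail _ hstep ih => exact ih (closedAt_of_redStepE hstep hc)

/-- **Irreducible for the extended calculus**: no extended step applies. -/
def IrreducibleE (o a₁ a₂ a₃ b : V) (E : Type u) [Fintype E] [DecidableEq E] (ends : E → Sym2 V) :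
    Prop :=
  ¬ ∃ (o' a₁' a₂' a₃' b' : V) (E' : Type u) (_ : Fintype E') (_ : DecidableEq E')
    (ends' : E' → Sym2 V), RedStepE o a₁ a₂ a₃ b E ends o' a₁' a₂' a₃' b' E' ends'

/-- An extended step followed by an extended reduction is an extended reduction. -/
theorem ReducesE.head {o a₁ a₂ a₃ b : V} {E : Type u} [Fintype E] [DecidableEq E]
    {ends : E → Sym2 V} {om a₁m a₂m a₃m bm : V} {Em : Type u} [Fintype Em] [DecidableEq Em]
    {endsm : Em → Sym2 V} {o' a₁' a₂' a₃' b' : V} {E' : Type u} [Fintype E'] [DecidableEq E']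
    {ends' : E' → Sym2 V} (hstep : RedStepE o a₁ a₂ a₃ b E ends om a₁m a₂m a₃m bm Em endsm)
    (h : ReducesE om a₁m a₂m a₃m bm Em endsm o' a₁' a₂' a₃' b' E' ends') :
    ReducesE o a₁ a₂ a₃ b E ends o' a₁' a₂' a₃' b' E' ends' := by
  induction h with
  | refl => exact ReducesE.tail (ReducesE.refl o a₁ a₂ a₃ b E ends) hstep
  | tail _ hstep' ih => exact ReducesE.tail ih hstep'

/-- **Every instance reduces, in the extended calculus, to an irreducible instance.** -/
theorem exists_irreducibleE_reducesE :
    ∀ (n : ℕ) (o a₁ a₂ a₃ b : V) (E : Type u) [Fintype E] [DecidableEq E] (ends : E → Sym2 V),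
      Fintype.card E = n →
      ∃ (o' a₁' a₂' a₃' b' : V) (E' : Type u) (_ : Fintype E') (_ : DecidableEq E')
        (ends' : E' → Sym2 V), IrreducibleE o' a₁' a₂' a₃' b' E' ends' ∧
          ReducesE o a₁ a₂ a₃ b E ends o' a₁' a₂' a₃' b' E' ends' := by
  intro n
  induction n using Nat.strong_induction_on with
  | _ n ih =>
    intro o a₁ a₂ a₃ b E _ _ ends hn
    by_cases hred : ∃ (o' a₁' a₂' a₃' b' : V) (E' : Type u) (_ : Fintype E') (_ : DecidableEq E')
        (ends' : E' → Sym2 V), RedStepE o a₁ a₂ a₃ b E ends o' a₁' a₂' a₃' b' E' ends'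
    · obtain ⟨om, a₁m, a₂m, a₃m, bm, Em, _, _, endsm, hstep⟩ := hred
      have hlt : Fintype.card Em < n := hn ▸ hstep.card_lt
      obtain ⟨o', a₁', a₂', a₃', b', E', _, _, ends', hirr, hred'⟩ :=
        ih _ hlt om a₁m a₂m a₃m bm Em endsm rfl
      exact ⟨o', a₁', a₂', a₃', b', E', _, _, ends', hirr, ReducesE.head hstep hred'⟩
    · exact ⟨o, a₁, a₂, a₃, b, E, _, _, ends, hred, ReducesE.refl o a₁ a₂ a₃ b E ends⟩

/-- **The reduction to the extended irreducible class**: if every `IrreducibleE` instance is closed,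
every instance is closed. -/
theorem closedAt_of_irreducibleE
    (hirr : ∀ (o a₁ a₂ a₃ b : V) (E : Type u) [Fintype E] [DecidableEq E] (ends : E → Sym2 V),
      IrreducibleE o a₁ a₂ a₃ b E ends → ClosedAt R o a₁ a₂ b E ends a₃)
    (o a₁ a₂ a₃ b : V) (E : Type u) [Fintype E] [DecidableEq E] (ends : E → Sym2 V) :
    ClosedAt R o a₁ a₂ b E ends a₃ := by
  obtain ⟨o', a₁', a₂', a₃', b', E', _, _, ends', hi, hr⟩ :=
    exists_irreducibleE_reducesE (Fintype.card E) o a₁ a₂ a₃ b E ends rfl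
  exact closedAt_of_reducesE hr (hirr o' a₁' a₂' a₃' b' E' ends' hi)

end RedE

section Reading
variable {V : Type*} {E : Type u} [Fintype E] [DecidableEq E] {ends : E → Sym2 V}
  {o a₁ a₂ a₃ b : V}

/-- An `IrreducibleE` instance is `Irreducible`. -/
theorem IrreducibleE.irreducible (h : IrreducibleE o a₁ a₂ a₃ b E ends) :
    Irreducible o a₁ a₂ a₃ b E ends := by
  rintro ⟨o', a₁', a₂', a₃', b', E', _, _, ends', hstep⟩
  exact h ⟨o', a₁', a₂', a₃', b', E', _, _, ends', RedStepE.base hstep⟩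

/-- In an `IrreducibleE` instance the roots are not adjacent. -/
theorem IrreducibleE.not_root_edge (h : IrreducibleE o a₁ a₂ a₃ b E ends) {e₀ : E}
    (he : ends e₀ = s(a₁, a₂)) : False :=
  h ⟨o, a₁, a₂, a₃, b, {e : E // e ≠ e₀}, _, _, restrictEnds ends e₀,
    RedStepE.rootEdge E ends a₁ a₂ e₀ he⟩

end Reading

end CaseOne

end Summit.Ventures.PercRepro2
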